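import Mathlib
import Literature.Probability.LatticeModels.TorusFourierWeightedL1Prod
import Literature.Probability.LatticeModels.TorusAdditiveWeightSum
import Literature.Probability.LatticeModels.TorusInverseQuadraticWeightSum
import HarnessLib

/-!
# A position MOMENT of a space-time character sum with the ADDITIVE weight: `Σ m·‖S‖ ≤ √(Σ m²/W)·√(Σ W‖S‖²)` — only PURE differences of
# the symbol (orders `N₀` in time, `N₁` in space), and the time-moment weight sum `Σ X²/(1 + X¹² + Y₁⁴ + Y₂⁴)`

Topic `Probability/LatticeModels`; companion of `TorusFourierWeightedL1Prod` (`sum_sum_norm_prodChar_le`: the `ℓ¹` norm of a product-torus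
character sum `S[G](a,b) = Σ_{p,p'} χ_p(a)χ_{p'}(b) G(p,p')` from the additive weight `1 + c₀X^{2N} + Σ_i c_iY_i^{2N}` and pure `N`-th
differences), `TorusAdditiveWeightSum` (the inverse additive weight is summable: AM–GM `(1+u+v+w)⁻¹ ≤ ∏(1+·)^{-1/3}` and the one-dimensional
sums `Σ_{x ∈ ℤ/n}(1+(s|x̃|)⁴)^{-1/3} ≤ 2 + 12/s`) and `TorusFourierWeightedL1ProdMoment` (moments with a PRODUCT weight, paid by MIXED differences).
Here a monomial `m` is carried inside the `ℓ¹` sum WITHOUT mixed differences: Cauchy–Schwarz is applied to `(m/√W)·(√W‖S‖)`, so `m²` enters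
only the inverse-weight sum and `W` alone multiplies `‖S‖²` (Benfatto–Giuliani–Mastropietro 2006, Lemma 2.2 / (2.36aa): a position moment of
order one needs, with an additive weight of time order `N₀` and space order `N₁` on `(ℤ/N)¹ × (ℤ/L)²`, the anisotropic integrability
`3/(2N₀) + 2/(2N₁)·… < 1`; for the TIME moment `m = X` the choice `(N₀, N₁) = (6, 2)` works and keeps the space differences at order two —
the `K`-safe order for a symbol composed with a `C²` band, cell gate-hubbard-kl, K3 engine (E4)₀, multiplier weighted torus sum `T_w`):

* **`sum_sum_mul_norm_prodChar_le_additive`** — for `m ≥ 0`, `c₀, c_i ≥ 0` and orders `N₀, N₁`: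
  `Σ_{a,b} m(a,b)‖S[G](a,b)‖ ≤ √(Σ_{a,b} m²·W⁻¹) · √(L₁^{d₁}L₂^{d₂}(Σ‖G‖² + c₀Σ‖Δ_u^{N₀}G‖² + Σ_i c_iΣ‖Δ_{v_i}^{N₁}G‖²))`,
  `W = 1 + c₀(4|ã_u|/L₁)^{2N₀} + Σ_i c_i(4|b̃_{v_i}|/L₂)^{2N₁}`;
* `sq_mul_rpow_one_add_pow_twelve_le` (`t²(1+t¹²)^{-1/3} ≤ 2(1+t²)⁻¹`), `sum_zmod_sq_mul_rpow_le` (`Σ_{x∈ℤ/n}(s|x̃|)²(1+(s|x̃|)¹²)^{-1/3} ≤ 4 + 2π/s`,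
  via `TorusInverseQuadraticWeightSum.sum_zmod_inv_one_add_sq_valMinAbs_le`);
* **`sum_timeMomentWeight_le`** — `Σ_{(a,b) ∈ (ℤ/N)¹×(ℤ/L)²} (s₀|ã|)²·(1 + (s₀|ã|)¹² + Σ_i (t_i|b̃_i|)⁴)⁻¹ ≤ (4 + 2π/s₀)·∏_i (2 + 12/t_i)`
  (`≍` the first time moment of the indicator of the decay box, `s₀⁻¹·s₀⁻¹t₁⁻¹t₂⁻¹` in lattice units times `s₀`).

Everything is proved; no definitions, no named facts.

## Sources

G. Benfatto, A. Giuliani, V. Mastropietro, Ann. Henri Poincaré 7 (2006) 809–898, Lemma 2.2, (2.36aa), (3.3) and footnote ¹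
(`BenfattoGiulianiMastropietro2006`); S. Friedli, Y. Velenik, *Statistical Mechanics of Lattice Systems* (2017), §10.4 (`FriedliVelenik2017`).
-/

noncomputable section

open Finset Real

namespace Literature.Probability.LatticeModels

/-! ### §1 Cauchy–Schwarz with a monomial and the additive weight of orders `(N₀, N₁)` -/

section CS

variable {d₁ L₁ d₂ L₂ : ℕ} [NeZero L₁] [NeZero L₂]

omit [NeZero L₁] [NeZero L₂] in
/-- Cauchy–Schwarz `Σ m‖g‖ ≤ √(Σ m²/W)·√(Σ W‖g‖²)` for a positive weight `W` and `m ≥ 0`. [cite: BenfattoGiulianiMastropietro2006, Lemma 2.2 and footnote 1] -/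
theorem sum_mul_norm_le_of_weight {ι : Type*} (s : Finset ι) (g : ι → ℂ) (m W : ι → ℝ) (hm : ∀ x ∈ s, 0 ≤ m x)
    (hW : ∀ x ∈ s, 0 < W x) :
    ∑ x ∈ s, m x * ‖g x‖ ≤ Real.sqrt (∑ x ∈ s, m x ^ 2 * (W x)⁻¹) * Real.sqrt (∑ x ∈ s, W x * ‖g x‖ ^ 2) := by
  have hcs := sum_mul_sq_le_sq_mul_sq s (fun x => m x * Real.sqrt ((W x)⁻¹)) (fun x => Real.sqrt (W x) * ‖g x‖)
  have hprod : ∀ x ∈ s, m x * Real.sqrt ((W x)⁻¹) * (Real.sqrt (W x) * ‖g x‖) = m x * ‖g x‖ := by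
    intro x hx
    have h : Real.sqrt ((W x)⁻¹) * Real.sqrt (W x) = 1 := by
      rw [Real.sqrt_inv, inv_mul_cancel₀ (Real.sqrt_ne_zero'.2 (hW x hx))]
    calc m x * Real.sqrt ((W x)⁻¹) * (Real.sqrt (W x) * ‖g x‖) = m x * (Real.sqrt ((W x)⁻¹) * Real.sqrt (W x)) * ‖g x‖ := by ring
      _ = m x * ‖g x‖ := by rw [h, mul_one]
  have h1 : ∀ x ∈ s, (m x * Real.sqrt ((W x)⁻¹)) ^ 2 = m x ^ 2 * (W x)⁻¹ := fun x hx => by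
    rw [mul_pow, Real.sq_sqrt (inv_nonneg.2 (hW x hx).le)]
  have h2 : ∀ x ∈ s, (Real.sqrt (W x) * ‖g x‖) ^ 2 = W x * ‖g x‖ ^ 2 := fun x hx => by
    rw [mul_pow, Real.sq_sqrt (hW x hx).le]
  rw [sum_congr rfl hprod, sum_congr rfl h1, sum_congr rfl h2] at hcs
  have hA : 0 ≤ ∑ x ∈ s, m x ^ 2 * (W x)⁻¹ := sum_nonneg fun x hx => mul_nonneg (sq_nonneg _) (inv_nonneg.2 (hW x hx).le)
  have hS : 0 ≤ ∑ x ∈ s, m x * ‖g x‖ := sum_nonneg fun x hx => mul_nonneg (hm x hx) (norm_nonneg _)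
  rw [← Real.sqrt_mul hA, ← Real.sqrt_sq hS]
  exact Real.sqrt_le_sqrt hcs

/-- **Weighted Plancherel with the additive weight of orders `(N₀, N₁)`**: for `c₀, c_i ≥ 0`,
`Σ_{a,b} W(a,b)‖S[G](a,b)‖² ≤ L₁^{d₁}L₂^{d₂}(Σ‖G‖² + c₀Σ‖Δ_u^{N₀}G‖² + Σ_i c_iΣ‖Δ_{v_i}^{N₁}G‖²)`,
`W = 1 + c₀(4|ã_u|/L₁)^{2N₀} + Σ_i c_i(4|b̃_{v_i}|/L₂)^{2N₁}`. [cite: BenfattoGiulianiMastropietro2006, Lemma 2.2 and (2.36aa)] -/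
theorem sum_sum_addWeight_mul_norm_sq_le {ι : Type*} (T : Finset ι) (u : TorusSite d₁ L₁) (c₀ : ℝ) (hc₀ : 0 ≤ c₀)
    (v : ι → TorusSite d₂ L₂) (c : ι → ℝ) (hc : ∀ i ∈ T, 0 ≤ c i) (N₀ N₁ : ℕ) (G : TorusSite d₁ L₁ → TorusSite d₂ L₂ → ℂ) :
    ∑ a : TorusSite d₁ L₁, ∑ b : TorusSite d₂ L₂,
        (1 + c₀ * (4 * |((∑ j, u j * a j).valMinAbs : ℝ)| / L₁) ^ (2 * N₀) +
            ∑ i ∈ T, c i * (4 * |((∑ j, v i j * b j).valMinAbs : ℝ)| / L₂) ^ (2 * N₁)) *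
          ‖∑ p, ∑ p', torusChar p a * torusChar p' b * G p p'‖ ^ 2 ≤
      (L₁ : ℝ) ^ d₁ * (L₂ : ℝ) ^ d₂ *
        (∑ p, ∑ p', ‖G p p'‖ ^ 2 + c₀ * ∑ p, ∑ p', ‖((fwdDiff u)^[N₀] (fun q => G q p')) p‖ ^ 2 +
          ∑ i ∈ T, c i * ∑ p, ∑ p', ‖((fwdDiff (v i))^[N₁] (G p)) p'‖ ^ 2) := by
  set S : TorusSite d₁ L₁ × TorusSite d₂ L₂ → ℂ := fun ab => ∑ p, ∑ p', torusChar p ab.1 * torusChar p' ab.2 * G p p' with hS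
  set wu : TorusSite d₁ L₁ → ℝ := fun a => (4 * |((∑ j, u j * a j).valMinAbs : ℝ)| / L₁) ^ (2 * N₀) with hwu
  set wv : ι → TorusSite d₂ L₂ → ℝ := fun i b => (4 * |((∑ j, v i j * b j).valMinAbs : ℝ)| / L₂) ^ (2 * N₁) with hwv
  have hpt : ∀ (a : TorusSite d₁ L₁) (b : TorusSite d₂ L₂), (1 + c₀ * wu a + ∑ i ∈ T, c i * wv i b) * ‖S (a, b)‖ ^ 2 =
      ‖S (a, b)‖ ^ 2 + c₀ * (wu a * ‖S (a, b)‖ ^ 2) + ∑ i ∈ T, c i * (wv i b * ‖S (a, b)‖ ^ 2) := by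
    intro a b
    rw [add_mul, add_mul, one_mul, sum_mul]
    congr 1
    · ring
    · exact sum_congr rfl fun i _ => by ring
  have hinner : ∀ a : TorusSite d₁ L₁, ∑ b : TorusSite d₂ L₂, (1 + c₀ * wu a + ∑ i ∈ T, c i * wv i b) * ‖S (a, b)‖ ^ 2 =
      ∑ b : TorusSite d₂ L₂, ‖S (a, b)‖ ^ 2 + c₀ * ∑ b : TorusSite d₂ L₂, wu a * ‖S (a, b)‖ ^ 2 +
        ∑ i ∈ T, c i * ∑ b : TorusSite d₂ L₂, wv i b * ‖S (a, b)‖ ^ 2 := by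
    intro a
    simp_rw [hpt]
    rw [sum_add_distrib, sum_add_distrib, mul_sum, sum_comm]
    simp_rw [mul_sum]
  have hsplit : ∑ a : TorusSite d₁ L₁, ∑ b : TorusSite d₂ L₂, (1 + c₀ * wu a + ∑ i ∈ T, c i * wv i b) * ‖S (a, b)‖ ^ 2 =
      ∑ a : TorusSite d₁ L₁, ∑ b : TorusSite d₂ L₂, ‖S (a, b)‖ ^ 2 +
        c₀ * ∑ a : TorusSite d₁ L₁, ∑ b : TorusSite d₂ L₂, wu a * ‖S (a, b)‖ ^ 2 +
        ∑ i ∈ T, c i * ∑ a : TorusSite d₁ L₁, ∑ b : TorusSite d₂ L₂, wv i b * ‖S (a, b)‖ ^ 2 := by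
    simp_rw [hinner]
    have h3 : ∑ a : TorusSite d₁ L₁, ∑ i ∈ T, c i * ∑ b : TorusSite d₂ L₂, wv i b * ‖S (a, b)‖ ^ 2 =
        ∑ i ∈ T, c i * ∑ a : TorusSite d₁ L₁, ∑ b : TorusSite d₂ L₂, wv i b * ‖S (a, b)‖ ^ 2 := by
      rw [sum_comm]
      refine sum_congr rfl fun i _ => ?_
      rw [mul_sum]
    rw [sum_add_distrib, sum_add_distrib, h3, ← mul_sum]
  have hgoal : ∑ a : TorusSite d₁ L₁, ∑ b : TorusSite d₂ L₂,
      (1 + c₀ * (4 * |((∑ j, u j * a j).valMinAbs : ℝ)| / L₁) ^ (2 * N₀) +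
          ∑ i ∈ T, c i * (4 * |((∑ j, v i j * b j).valMinAbs : ℝ)| / L₂) ^ (2 * N₁)) *
        ‖∑ p, ∑ p', torusChar p a * torusChar p' b * G p p'‖ ^ 2 =
      ∑ a : TorusSite d₁ L₁, ∑ b : TorusSite d₂ L₂, (1 + c₀ * wu a + ∑ i ∈ T, c i * wv i b) * ‖S (a, b)‖ ^ 2 := rfl
  rw [hgoal, hsplit]
  have h0 := sum_sum_norm_sq_prodChar G
  have h1 := sum_sum_weight_fst_mul_norm_sq_le G u N₀
  have h2 := fun i => sum_sum_weight_snd_mul_norm_sq_le G (v i) N₁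
  simp only [hS, hwu, hwv] at h0 h1 h2 ⊢
  rw [h0, mul_add, mul_add]
  refine add_le_add (add_le_add le_rfl ?_) ?_
  · rw [mul_left_comm]
    exact mul_le_mul_of_nonneg_left h1 hc₀
  · rw [mul_sum]
    refine sum_le_sum fun i hi => ?_
    rw [mul_left_comm]
    exact mul_le_mul_of_nonneg_left (h2 i) (hc i hi)

/-- **A position moment from PURE differences** (additive weight of orders `(N₀, N₁)`): for a nonnegative weight function `m` on
`(ℤ/L₁)^{d₁} × (ℤ/L₂)^{d₂}` and `c₀, c_i ≥ 0`,
`Σ_{a,b} m(a,b)‖S[G](a,b)‖ ≤ √(Σ_{a,b} m(a,b)²·W(a,b)⁻¹) · √(L₁^{d₁}L₂^{d₂}(Σ‖G‖² + c₀Σ‖Δ_u^{N₀}G‖² + Σ_i c_iΣ‖Δ_{v_i}^{N₁}G‖²))`.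
[cite: BenfattoGiulianiMastropietro2006, Lemma 2.2, (2.36aa) and (3.3)] -/
theorem sum_sum_mul_norm_prodChar_le_additive {ι : Type*} (T : Finset ι) (u : TorusSite d₁ L₁) (c₀ : ℝ) (hc₀ : 0 ≤ c₀)
    (v : ι → TorusSite d₂ L₂) (c : ι → ℝ) (hc : ∀ i ∈ T, 0 ≤ c i) (N₀ N₁ : ℕ)
    (m : TorusSite d₁ L₁ → TorusSite d₂ L₂ → ℝ) (hm : ∀ a b, 0 ≤ m a b) (G : TorusSite d₁ L₁ → TorusSite d₂ L₂ → ℂ) :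
    ∑ a : TorusSite d₁ L₁, ∑ b : TorusSite d₂ L₂, m a b * ‖∑ p, ∑ p', torusChar p a * torusChar p' b * G p p'‖ ≤
      Real.sqrt (∑ a : TorusSite d₁ L₁, ∑ b : TorusSite d₂ L₂, m a b ^ 2 *
          (1 + c₀ * (4 * |((∑ j, u j * a j).valMinAbs : ℝ)| / L₁) ^ (2 * N₀) +
            ∑ i ∈ T, c i * (4 * |((∑ j, v i j * b j).valMinAbs : ℝ)| / L₂) ^ (2 * N₁))⁻¹) *
        Real.sqrt ((L₁ : ℝ) ^ d₁ * (L₂ : ℝ) ^ d₂ *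
          (∑ p, ∑ p', ‖G p p'‖ ^ 2 + c₀ * ∑ p, ∑ p', ‖((fwdDiff u)^[N₀] (fun q => G q p')) p‖ ^ 2 +
            ∑ i ∈ T, c i * ∑ p, ∑ p', ‖((fwdDiff (v i))^[N₁] (G p)) p'‖ ^ 2)) := by
  set W : TorusSite d₁ L₁ × TorusSite d₂ L₂ → ℝ := fun ab =>
    1 + c₀ * (4 * |((∑ j, u j * ab.1 j).valMinAbs : ℝ)| / L₁) ^ (2 * N₀) +
      ∑ i ∈ T, c i * (4 * |((∑ j, v i j * ab.2 j).valMinAbs : ℝ)| / L₂) ^ (2 * N₁) with hW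
  set S : TorusSite d₁ L₁ × TorusSite d₂ L₂ → ℂ := fun ab => ∑ p, ∑ p', torusChar p ab.1 * torusChar p' ab.2 * G p p' with hS
  have hWpos : ∀ ab ∈ (univ : Finset (TorusSite d₁ L₁ × TorusSite d₂ L₂)), 0 < W ab := fun ab _ => by
    rw [hW]
    exact add_pos_of_pos_of_nonneg (add_pos_of_pos_of_nonneg one_pos (mul_nonneg hc₀ (by positivity)))
      (sum_nonneg fun i hi => mul_nonneg (hc i hi) (by positivity))
  have hcs := sum_mul_norm_le_of_weight univ S (fun ab => m ab.1 ab.2) W (fun ab _ => hm ab.1 ab.2) hWpos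
  rw [← univ_product_univ, sum_product, sum_product, sum_product] at hcs
  refine hcs.trans (mul_le_mul_of_nonneg_left (Real.sqrt_le_sqrt ?_) (Real.sqrt_nonneg _))
  exact sum_sum_addWeight_mul_norm_sq_le T u c₀ hc₀ v c hc N₀ N₁ G

end CS

/-! ### §2 One-dimensional sums for the time-moment weight -/

/-- `t²·(1 + t¹²)^{-1/3} ≤ 2·(1 + t²)⁻¹` for `t ≥ 0` (`t ≤ 1`: both sides against `1`; `t ≥ 1`: `(1+t¹²)^{1/3} ≥ t⁴` and `1 + t² ≤ 2t²`).
[cite: FriedliVelenik2017, §10.4] -/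
theorem sq_mul_rpow_one_add_pow_twelve_le {t : ℝ} (ht : 0 ≤ t) :
    t ^ 2 * (1 + t ^ 12) ^ (-(1 / 3 : ℝ)) ≤ 2 * (1 + t ^ 2)⁻¹ := by
  rcases le_or_gt t 1 with h | h
  · -- `t ≤ 1`
    have hr : (1 + t ^ 12) ^ (-(1 / 3 : ℝ)) ≤ 1 := by
      rw [Real.rpow_neg (by positivity)]
      exact inv_le_one_of_one_le₀ (Real.one_le_rpow (by nlinarith [pow_nonneg ht 12]) (by norm_num))
    have hsq : 1 + t ^ 2 ≤ 2 := by nlinarith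
    calc t ^ 2 * (1 + t ^ 12) ^ (-(1 / 3 : ℝ)) ≤ 1 * 1 := mul_le_mul (by nlinarith) hr (by positivity) zero_le_one
      _ = 2 * (2 : ℝ)⁻¹ := by norm_num
      _ ≤ 2 * (1 + t ^ 2)⁻¹ := by gcongr
  · -- `1 < t`: `(1 + t¹²)^{-1/3} ≤ (t¹²)^{-1/3} = (t⁴)⁻¹`
    have ht0 : 0 < t := by linarith
    have hr : (1 + t ^ 12) ^ (-(1 / 3 : ℝ)) ≤ (t ^ 12) ^ (-(1 / 3 : ℝ)) :=
      Real.rpow_le_rpow_of_nonpos (by positivity) (by linarith) (by norm_num)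
    have heq : (t ^ 12 : ℝ) ^ (-(1 / 3 : ℝ)) = (t ^ 4)⁻¹ := by
      rw [show (t ^ 12 : ℝ) = t ^ ((12 : ℕ) : ℝ) by rw [Real.rpow_natCast], ← Real.rpow_mul ht,
        show ((12 : ℕ) : ℝ) * -(1 / 3 : ℝ) = -((4 : ℕ) : ℝ) by norm_num, Real.rpow_neg ht, Real.rpow_natCast]
    rw [heq] at hr
    have h4 : 1 + t ^ 2 ≤ 2 * t ^ 2 := by nlinarith
    calc t ^ 2 * (1 + t ^ 12) ^ (-(1 / 3 : ℝ)) ≤ t ^ 2 * (t ^ 4)⁻¹ := mul_le_mul_of_nonneg_left hr (sq_nonneg t)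
      _ = (t ^ 2)⁻¹ := by field_simp
      _ ≤ 2 * (1 + t ^ 2)⁻¹ := by
          rw [← div_eq_mul_inv, le_div_iff₀ (by positivity), inv_mul_le_iff₀ (by positivity)]
          linarith

/-- **The time factor of the moment weight**: `Σ_{x ∈ ℤ/n} (s|x̃|)²·(1 + (s|x̃|)¹²)^{-1/3} ≤ 4 + 2π/s` (`s > 0`;
`TorusInverseQuadraticWeightSum.sum_zmod_inv_one_add_sq_valMinAbs_le`). [cite: FriedliVelenik2017, §10.4] -/
theorem sum_zmod_sq_mul_rpow_le {n : ℕ} [NeZero n] {s : ℝ} (hs : 0 < s) :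
    ∑ x : ZMod n, (s * |((x.valMinAbs : ℤ) : ℝ)|) ^ 2 * (1 + (s * |((x.valMinAbs : ℤ) : ℝ)|) ^ 12) ^ (-(1 / 3 : ℝ)) ≤
      4 + 2 * Real.pi / s := by
  have h := sum_zmod_inv_one_add_sq_valMinAbs_le (n := n) hs
  calc ∑ x : ZMod n, (s * |((x.valMinAbs : ℤ) : ℝ)|) ^ 2 * (1 + (s * |((x.valMinAbs : ℤ) : ℝ)|) ^ 12) ^ (-(1 / 3 : ℝ))
      ≤ ∑ x : ZMod n, 2 * (1 + (s * |((x.valMinAbs : ℤ) : ℝ)|) ^ 2)⁻¹ :=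
        sum_le_sum fun x _ => sq_mul_rpow_one_add_pow_twelve_le (by positivity)
    _ = 2 * ∑ x : ZMod n, (1 + (s * |((x.valMinAbs : ℤ) : ℝ)|) ^ 2)⁻¹ := by rw [mul_sum]
    _ ≤ 2 * (2 + Real.pi / s) := mul_le_mul_of_nonneg_left h (by norm_num)
    _ = 4 + 2 * Real.pi / s := by ring

/-! ### §3 The three-dimensional time-moment weight sum -/

/-- **The time-moment weight sum is uniform in the lattice sizes**: for rates `s₀, t₁, t₂ > 0`,
`Σ_{a ∈ (ℤ/N)¹} Σ_{b ∈ (ℤ/L)²} (s₀|ã|)²·(1 + (s₀|ã|)¹² + Σ_i (t_i|b̃_i|)⁴)⁻¹ ≤ (4 + 2π/s₀)·∏_i (2 + 12/t_i)`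
(AM–GM `(1+u+v+w)⁻¹ ≤ ∏(1+·)^{-1/3}`, then the sums factorise). [cite: BenfattoGiulianiMastropietro2006, Lemma 2.2 and footnote 1] -/
theorem sum_timeMomentWeight_le {N L : ℕ} [NeZero N] [NeZero L] {s₀ : ℝ} (hs₀ : 0 < s₀) (t : Fin 2 → ℝ) (ht : ∀ i, 0 < t i) :
    ∑ a : TorusSite 1 N, ∑ b : TorusSite 2 L,
        (s₀ * |(((a 0).valMinAbs : ℤ) : ℝ)|) ^ 2 *
          (1 + (s₀ * |(((a 0).valMinAbs : ℤ) : ℝ)|) ^ 12 + ∑ i, (t i * |(((b i).valMinAbs : ℤ) : ℝ)|) ^ 4)⁻¹ ≤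
      (4 + 2 * Real.pi / s₀) * ∏ i, (2 + 12 / t i) := by
  -- AM–GM pointwise, then the sums factorise
  have hpt : ∀ (a : TorusSite 1 N) (b : TorusSite 2 L),
      (s₀ * |(((a 0).valMinAbs : ℤ) : ℝ)|) ^ 2 *
          (1 + (s₀ * |(((a 0).valMinAbs : ℤ) : ℝ)|) ^ 12 + ∑ i, (t i * |(((b i).valMinAbs : ℤ) : ℝ)|) ^ 4)⁻¹ ≤
        ((s₀ * |(((a 0).valMinAbs : ℤ) : ℝ)|) ^ 2 * (1 + (s₀ * |(((a 0).valMinAbs : ℤ) : ℝ)|) ^ 12) ^ (-(1 / 3 : ℝ))) *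
          ∏ i, (1 + (t i * |(((b i).valMinAbs : ℤ) : ℝ)|) ^ 4) ^ (-(1 / 3 : ℝ)) := by
    intro a b
    rw [Fin.sum_univ_two, Fin.prod_univ_two, ← add_assoc, mul_assoc, ← mul_assoc ((1 + _) ^ _)]
    exact mul_le_mul_of_nonneg_left (inv_one_add_three_le_rpow_prod (by positivity) (by positivity) (by positivity))
      (sq_nonneg _)
  refine (sum_le_sum fun a _ => sum_le_sum fun b _ => hpt a b).trans ?_
  simp_rw [← mul_sum, ← sum_mul]
  refine mul_le_mul ?_ ?_ (sum_nonneg fun b _ => prod_nonneg fun i _ => by positivity) (by positivity)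
  · -- the time direction: `(ℤ/N)¹ ≃ ℤ/N`
    rw [show (∑ a : TorusSite 1 N, (s₀ * |(((a 0).valMinAbs : ℤ) : ℝ)|) ^ 2 *
          (1 + (s₀ * |(((a 0).valMinAbs : ℤ) : ℝ)|) ^ 12) ^ (-(1 / 3 : ℝ))) =
        ∑ z : ZMod N, (s₀ * |((z.valMinAbs : ℤ) : ℝ)|) ^ 2 * (1 + (s₀ * |((z.valMinAbs : ℤ) : ℝ)|) ^ 12) ^ (-(1 / 3 : ℝ)) from
      Fintype.sum_equiv (Equiv.funUnique (Fin 1) (ZMod N)) _ _ fun a => rfl]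
    exact sum_zmod_sq_mul_rpow_le hs₀
  · -- the two space directions factorise
    rw [← Fintype.piFinset_univ, ← Finset.prod_univ_sum (fun _ : Fin 2 => (univ : Finset (ZMod L)))
      fun i (z : ZMod L) => (1 + (t i * |((z.valMinAbs : ℤ) : ℝ)|) ^ 4) ^ (-(1 / 3 : ℝ))]
    exact prod_le_prod (fun i _ => sum_nonneg fun z _ => by positivity)
      fun i _ => sum_zmod_rpow_one_add_valMinAbs_pow_four_le (ht i)

end Literature.Probability.LatticeModels

end
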